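import Summits.QuantumFields.YangMills.Theorems.LuscherReductionTwistedTraceScalingBOTransport
import Summits.QuantumFields.YangMills.Theorems.LuscherReductionTwistedTraceScalingBTCoreWeight
import HarnessLib

/-!
# (C2-moments, step (ii)) MOMENT TRANSPORT OF THE FIBRE TRANSFER: the defect of the transported fibre transfer against the central one is bounded by CENTRAL transfers of
# REWEIGHTED profiles/weights — `Ω·‖x‖²`, `Ω·‖x‖⁴`, `W·G`, `W·G²` (`G(g) = Σ_x ‖q(g_x) − 1‖²`) — once the transport exponent is a polynomial in the kept size
# (route `FlatTubeReduction`, crux K1 `NearFlatRatioLaw` stmt-QuantumFields-24720, line «ratepack_v2» skeleton v6, stub `stub_hODpot_A`; seat `ym-line-ftr-p1` g18;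
# memo `Cruxes/NearFlatRatioLaw/Lines/ratepack-v6-port-g17.md` §§6–7; R2b1 RECORD rung — no summit statement is proved here)

WHY.  Lane A's `…BOTransport.fpFibreTransfer_two_sided` transports `F(u',v';u) = fpFibreTransfer β Ω W (oT u' v') u` to the centre MULTIPLICATIVELY, `e^{−η}ρT₁ ≤ F ≤ e^{η}ρT₁`, from
a UNIFORM bound `|offX + diagX| ≤ η` on the supports.  For the rate `O(λ_b)` of `stub_hODpot_A` the exponent must be kept as a polynomial of the actual size
`S(v,g) = ‖v̂'‖² + ‖v̂‖² + G(g)` (`…TransportExponentKept.abs_transportExponent_le_poly`), and then the defect `|F − ρT₁|` is bounded ADDITIVELY by `2ρ·∫ J·(c₀ + c₁S + c₂S²)`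
(`J` the central integrand, `|e^X − 1| ≤ 2|X|` for `|X| ≤ 1`), i.e. by central fibre transfers of the reweighted profile `Ω·‖x‖^{2k}` and the reweighted gauge weight `W·G^j`
(`k, j ≤ 2`).  Those reweighted CENTRAL transfers are the analytic inputs of the (C2-moments) route (memo §6 (x), (g)); everything here is bookkeeping.
* §1 `gaugeDev`-free helpers: measurability/boundedness of `g ↦ Σ_x ‖q(g_x) − 1‖²` (via `2 − Re tr = ‖q − 1‖²`), of the reweighted integrands;
* §2 ★★★ `fpFibreTransfer_sub_central_le_moments` — for `Ω ≥ 0` bounded measurable supported in `‖x‖ ≤ R`, `W ≥ 0` bounded measurable, an output point `oT u' v'`, an input slow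
  point `u`, nonnegative `c₀, c₁, c₂` with `|offX β u' u v' v g + diagX β u' v' v g| ≤ c₀ + c₁S + c₂S² ≤ 1` on the supports:
  `|F − ρ·T₁| ≤ 2ρ·((c₀ + c₁s' + 3c₂s'²)·T[Ω,W] + c₁·(T[Ω‖·‖²,W] + T[Ω,W·G]) + 3c₂·(T[Ω‖·‖⁴,W] + T[Ω,W·G²]))`, `s' = ‖v̂'‖²`, `T[Ω̃,W̃] = fpFibreTransfer β Ω̃ W̃ (oT 1 v') 1`,
  `ρ = K₁(u',u)/K₁(1,1)`.
HONEST FRAMING: bookkeeping for a stub of the CONDITIONAL reduction route R2b1 (rate twin); the reweighted central transfers ((C2-moments) step (iii)), (C1)-rate, the assembly,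
(B-ST) and the crux remain OPEN; femto rung R2b1 (RECORD label); not infinite volume, not a mass gap, not Clay.  No defs, no named facts, no `sorry`.
-/

set_option autoImplicit false

noncomputable section

open MeasureTheory Filter Topology Real
open scoped BigOperators
open Literature.MathematicalPhysics.QuantumFieldTheory
open Literature.MathematicalPhysics.QuantumLattice

namespace Summit.QuantumFields.YangMills.Theorems.FemtoTransferGap.TwoLattice.ConstTube

open Summit.QuantumFields.YangMills.Theorems.FemtoTransferGap
open Summit.QuantumFields.YangMills.Theorems.FemtoTransferGap.TwoLattice
open Summit.QuantumFields.YangMills.Theorems.FemtoTransferGap.TwoLattice.Avg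
open Summit.QuantumFields.YangMills.Theorems.FemtoTransferGap.TwoLattice.Stiff (LinkSpace)

variable {L : ℕ} [NeZero L]

/-! ## §1 The gauge deviation `G(g) = Σ_x ‖q(g_x) − 1‖²` and the reweighted data -/

/-- `g ↦ Σ_x ‖q(g_x) − 1‖²` is continuous (`‖q − 1‖² = 2 − Re tr`). [folklore] -/
theorem continuous_gaugeDevSq : Continuous fun g : Site 3 L → SU2 => ∑ x, ‖su2Quat (g x) - 1‖ ^ 2 := by
  have hq := @Literature.MathematicalPhysics.QuantumFieldTheory.Balaban1983to89.T4HaarSU2Translate.continuous_su2Quat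
  refine continuous_finsetSum _ fun x _ => ?_
  exact ((hq.comp (continuous_apply x)).sub continuous_const).norm.pow 2

/-- `g ↦ Σ_x ‖q(g_x) − 1‖²` is measurable. [folklore] -/
theorem measurable_gaugeDevSq : Measurable fun g : Site 3 L → SU2 => ∑ x, ‖su2Quat (g x) - 1‖ ^ 2 := by
  haveI : SecondCountableTopology SU2 := secondCountableTopology_su2
  exact continuous_gaugeDevSq.measurable

/-- `0 ≤ Σ_x ‖q(g_x) − 1‖² ≤ 4|Λ|`. [folklore] -/
theorem gaugeDevSq_mem (g : Site 3 L → SU2) : 0 ≤ ∑ x, ‖su2Quat (g x) - 1‖ ^ 2 ∧ ∑ x, ‖su2Quat (g x) - 1‖ ^ 2 ≤ 4 * Fintype.card (Site 3 L) := by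
  refine ⟨Finset.sum_nonneg fun _ _ => sq_nonneg _, ?_⟩
  have h : ∀ x, ‖su2Quat (g x) - 1‖ ^ 2 ≤ 4 := fun x => by
    have h1 : ‖su2Quat (g x) - 1‖ ≤ 2 := by
      calc ‖su2Quat (g x) - 1‖ ≤ ‖su2Quat (g x)‖ + ‖(1 : Quaternion ℝ)‖ := norm_sub_le _ _
        _ = 2 := by rw [norm_su2Quat, norm_one]; norm_num
    nlinarith [norm_nonneg (su2Quat (g x) - 1)]
  calc ∑ x, ‖su2Quat (g x) - 1‖ ^ 2 ≤ ∑ _x : Site 3 L, (4 : ℝ) := Finset.sum_le_sum fun x _ => h x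
    _ = 4 * Fintype.card (Site 3 L) := by rw [Finset.sum_const, Finset.card_univ, nsmul_eq_mul, mul_comm]

/-- The reweighted profile `Ω·‖x‖^{2k}` is measurable, nonnegative and bounded by `CΩ·R^{2k}` when `Ω` is supported in `‖x‖ ≤ R`. [folklore] -/
theorem reweightedProfile_props {Ω : LinkSpace L → ℝ} (hΩm : Measurable Ω) {CΩ : ℝ} (hCΩ : ∀ x, |Ω x| ≤ CΩ) (hΩ0 : ∀ x, 0 ≤ Ω x) {R : ℝ}
    (hΩR : ∀ x, Ω x ≠ 0 → ‖x‖ ≤ R) (k : ℕ) :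
    Measurable (fun x => Ω x * (‖x‖ ^ 2) ^ k) ∧ (∀ x, |Ω x * (‖x‖ ^ 2) ^ k| ≤ CΩ * (R ^ 2) ^ k) ∧ (∀ x, 0 ≤ Ω x * (‖x‖ ^ 2) ^ k) := by
  refine ⟨hΩm.mul ((measurable_norm.pow_const 2).pow_const k), fun x => ?_, fun x => mul_nonneg (hΩ0 x) (by positivity)⟩
  have hC0 : 0 ≤ CΩ := (abs_nonneg _).trans (hCΩ 0)
  by_cases hx : Ω x = 0
  · rw [hx, zero_mul, abs_zero]
    have hR : 0 ≤ (R ^ 2) ^ k := by positivity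
    exact mul_nonneg hC0 hR
  · have hxR := hΩR x hx
    have hn : (‖x‖ ^ 2) ^ k ≤ (R ^ 2) ^ k := pow_le_pow_left₀ (sq_nonneg _) (pow_le_pow_left₀ (norm_nonneg _) hxR 2) k
    rw [abs_mul, abs_of_nonneg (by positivity : (0 : ℝ) ≤ (‖x‖ ^ 2) ^ k)]
    exact mul_le_mul (hCΩ x) hn (by positivity) hC0

/-- The reweighted gauge weight `W·G^j` is measurable, nonnegative and bounded by `CW·(4|Λ|)^j`. [folklore] -/
theorem reweightedWeight_props {W : (Site 3 L → SU2) → ℝ} (hW : Measurable W) {CW : ℝ} (hCW : ∀ g, |W g| ≤ CW) (hW0 : ∀ g, 0 ≤ W g) (j : ℕ) :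
    Measurable (fun g => W g * (∑ x, ‖su2Quat (g x) - 1‖ ^ 2) ^ j) ∧ (∀ g, |W g * (∑ x, ‖su2Quat (g x) - 1‖ ^ 2) ^ j| ≤ CW * (4 * Fintype.card (Site 3 L)) ^ j) ∧
      (∀ g, 0 ≤ W g * (∑ x, ‖su2Quat (g x) - 1‖ ^ 2) ^ j) := by
  have hC0 : 0 ≤ CW := (abs_nonneg _).trans (hCW 1)
  refine ⟨hW.mul (measurable_gaugeDevSq.pow_const j), fun g => ?_, fun g => mul_nonneg (hW0 g) (pow_nonneg (gaugeDevSq_mem g).1 j)⟩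
  obtain ⟨h0, h4⟩ := gaugeDevSq_mem g
  rw [abs_mul, abs_of_nonneg (pow_nonneg h0 j)]
  exact mul_le_mul (hCW g) (pow_le_pow_left₀ h0 h4 j) (pow_nonneg h0 j) hC0

/-! ## §2 ★★★ Moment transport -/

/-- ★★★ **MOMENT TRANSPORT OF THE FIBRE TRANSFER.**  Let `Ω ≥ 0` be bounded measurable and supported in `‖x‖ ≤ R`, `W ≥ 0` bounded measurable, `oT u' v'` an output tube point and
`u` an input slow point.  If on the supports the transport exponent is a polynomial in the kept size, `|offX β u' u v' v g + diagX β u' v' v g| ≤ c₀ + c₁·S + c₂·S²` with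
`S = ‖v̂'‖² + ‖v̂‖² + Σ_x ‖q(g_x) − 1‖²`, `c_i ≥ 0`, and `c₀ + c₁S + c₂S² ≤ 1` there, then with `ρ = K₁^{(L³β)}(u',u)/K₁^{(L³β)}(1,1)`, `s' = ‖v̂'‖²` and the CENTRAL transfers
`T[Ω̃,W̃] = fpFibreTransfer β Ω̃ W̃ (oT 1 v') 1`:
`|fpFibreTransfer β Ω W (oT u' v') u − ρ·T[Ω,W]| ≤ 2ρ·((c₀ + c₁s' + 3c₂s'²)·T[Ω,W] + c₁·(T[Ω‖·‖²,W] + T[Ω,W·G]) + 3c₂·(T[Ω‖·‖⁴,W] + T[Ω,W·G²]))`. [cite: Luscher1983, §3] -/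
theorem fpFibreTransfer_sub_central_le_moments (β : ℝ) {Ω : LinkSpace L → ℝ} (hΩm : Measurable Ω) {CΩ : ℝ} (hCΩ : ∀ x, |Ω x| ≤ CΩ) (hΩ0 : ∀ x, 0 ≤ Ω x)
    {R : ℝ} (hΩR : ∀ x, Ω x ≠ 0 → ‖x‖ ≤ R)
    {W : (Site 3 L → SU2) → ℝ} (hW : Measurable W) {CW : ℝ} (hCW : ∀ g, |W g| ≤ CW) (hW0 : ∀ g, 0 ≤ W g) (u u' : GaugeConfig 3 1 SU2) (v' : Edge 3 L → Fin 3 → ℝ)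
    {c₀ c₁ c₂ : ℝ} (hc₀ : 0 ≤ c₀) (hc₁ : 0 ≤ c₁) (hc₂ : 0 ≤ c₂)
    (hX : ∀ (v : Edge 3 L → Fin 3 → ℝ) (g : Site 3 L → SU2), Ω (linkEmbed L v) ≠ 0 → W g ≠ 0 →
      |offX L β u' u v' v g + diagX L β u' v' v g| ≤
          c₀ + c₁ * (‖linkEmbed L v'‖ ^ 2 + ‖linkEmbed L v‖ ^ 2 + ∑ x, ‖su2Quat (g x) - 1‖ ^ 2) + c₂ * (‖linkEmbed L v'‖ ^ 2 + ‖linkEmbed L v‖ ^ 2 + ∑ x, ‖su2Quat (g x) - 1‖ ^ 2) ^ 2 ∧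
        c₀ + c₁ * (‖linkEmbed L v'‖ ^ 2 + ‖linkEmbed L v‖ ^ 2 + ∑ x, ‖su2Quat (g x) - 1‖ ^ 2) + c₂ * (‖linkEmbed L v'‖ ^ 2 + ‖linkEmbed L v‖ ^ 2 + ∑ x, ‖su2Quat (g x) - 1‖ ^ 2) ^ 2 ≤ 1) :
    |fpFibreTransfer L β Ω W (orthoTube L u' v') u -
        (transferKernel su2Rep ((L : ℝ) ^ 3 * β) u' u / transferKernel su2Rep ((L : ℝ) ^ 3 * β) (1 : GaugeConfig 3 1 SU2) 1) * fpFibreTransfer L β Ω W (orthoTube L 1 v') 1| ≤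
      2 * (transferKernel su2Rep ((L : ℝ) ^ 3 * β) u' u / transferKernel su2Rep ((L : ℝ) ^ 3 * β) (1 : GaugeConfig 3 1 SU2) 1) *
        ((c₀ + c₁ * ‖linkEmbed L v'‖ ^ 2 + 3 * c₂ * (‖linkEmbed L v'‖ ^ 2) ^ 2) * fpFibreTransfer L β Ω W (orthoTube L 1 v') 1 +
          c₁ * (fpFibreTransfer L β (fun x => Ω x * (‖x‖ ^ 2) ^ 1) W (orthoTube L 1 v') 1 +
              fpFibreTransfer L β Ω (fun g => W g * (∑ x, ‖su2Quat (g x) - 1‖ ^ 2) ^ 1) (orthoTube L 1 v') 1) +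
          3 * c₂ * (fpFibreTransfer L β (fun x => Ω x * (‖x‖ ^ 2) ^ 2) W (orthoTube L 1 v') 1 +
              fpFibreTransfer L β Ω (fun g => W g * (∑ x, ‖su2Quat (g x) - 1‖ ^ 2) ^ 2) (orthoTube L 1 v') 1)) := by
  haveI := isFiniteMeasure_orthoTransverse L
  set μP : Measure ((Edge 3 L → Fin 3 → ℝ) × (Site 3 L → SU2)) := (orthoTransverse L).prod (gaugeMeasure L) with hμP
  set ρ : ℝ := transferKernel su2Rep ((L : ℝ) ^ 3 * β) u' u / transferKernel su2Rep ((L : ℝ) ^ 3 * β) (1 : GaugeConfig 3 1 SU2) 1 with hρ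
  have hρ0 : 0 < ρ := div_pos (transferKernel_pos _ _ _ _) (transferKernel_pos _ _ _ _)
  -- abbreviations for the sizes
  set s' : ℝ := ‖linkEmbed L v'‖ ^ 2 with hs'
  have hs'0 : 0 ≤ s' := sq_nonneg _
  -- the integrands: transported `I`, central `J`, and the four reweighted central integrands
  set I : (Edge 3 L → Fin 3 → ℝ) × (Site 3 L → SU2) → ℝ := fun p =>
    W p.2 * transferKernel su2Rep β (orthoTube L u' v') (gaugeTransform p.2 (orthoTube L u p.1)) * Ω (linkEmbed L p.1) with hI
  set J : (Edge 3 L → Fin 3 → ℝ) × (Site 3 L → SU2) → ℝ := fun p =>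
    W p.2 * transferKernel su2Rep β (orthoTube L 1 v') (gaugeTransform p.2 (orthoTube L 1 p.1)) * Ω (linkEmbed L p.1) with hJ
  set a : (Edge 3 L → Fin 3 → ℝ) × (Site 3 L → SU2) → ℝ := fun p => ‖linkEmbed L p.1‖ ^ 2 with ha
  set b : (Edge 3 L → Fin 3 → ℝ) × (Site 3 L → SU2) → ℝ := fun p => ∑ x, ‖su2Quat (p.2 x) - 1‖ ^ 2 with hb
  have ha0 : ∀ p, 0 ≤ a p := fun p => sq_nonneg _
  have hb0 : ∀ p, 0 ≤ b p := fun p => (gaugeDevSq_mem p.2).1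
  have ham : Measurable a := ((measurable_linkEmbed L).comp measurable_fst).norm.pow_const 2
  have hbm : Measurable b := measurable_gaugeDevSq.comp measurable_snd
  obtain ⟨BI, hBI⟩ := abs_fpFibreTransfer_integrand_le (L := L) β hCΩ hCW (orthoTube L u' v') u
  obtain ⟨BJ, hBJ⟩ := abs_fpFibreTransfer_integrand_le (L := L) β hCΩ hCW (orthoTube L 1 v') 1
  have hIm : Measurable I := measurable_fpFibreTransfer_integrand β hΩm hW _ _
  have hJm : Measurable J := measurable_fpFibreTransfer_integrand β hΩm hW _ _
  have hIint : Integrable I μP := integrable_of_measurable_abs_le μP hIm hBI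
  have hJint : Integrable J μP := integrable_of_measurable_abs_le μP hJm hBJ
  have hJ0 : ∀ p, 0 ≤ J p := fun p => mul_nonneg (mul_nonneg (hW0 _) (transferKernel_pos su2Rep β _ _).le) (hΩ0 _)
  have hBJ0 : 0 ≤ BJ := (abs_nonneg _).trans (hBJ (0, 1))
  -- reweighted integrands are `J·a^k`, `J·b^j`: integrable (bounded measurable)
  obtain ⟨hR1, hR4⟩ : (0 : ℝ) ≤ (R ^ 2) ^ 1 ∧ (0 : ℝ) ≤ (R ^ 2) ^ 2 := ⟨by positivity, by positivity⟩
  have hJa_int : ∀ k : ℕ, Integrable (fun p => J p * a p ^ k) μP := fun k => by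
    refine integrable_of_measurable_abs_le μP (hJm.mul (ham.pow_const k)) (C := BJ * (R ^ 2) ^ k) fun p => ?_
    rw [abs_mul, abs_of_nonneg (pow_nonneg (ha0 p) k)]
    by_cases hΩp : Ω (linkEmbed L p.1) = 0
    · have : J p = 0 := by rw [hJ]; dsimp only; rw [hΩp, mul_zero]
      rw [this, abs_zero, zero_mul]; positivity
    · exact mul_le_mul (hBJ p) (pow_le_pow_left₀ (ha0 p) (by rw [ha]; exact pow_le_pow_left₀ (norm_nonneg _) (hΩR _ hΩp) 2) k) (pow_nonneg (ha0 p) k) hBJ0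
  have hJb_int : ∀ j : ℕ, Integrable (fun p => J p * b p ^ j) μP := fun j => by
    refine integrable_of_measurable_abs_le μP (hJm.mul (hbm.pow_const j)) (C := BJ * (4 * Fintype.card (Site 3 L)) ^ j) fun p => ?_
    rw [abs_mul, abs_of_nonneg (pow_nonneg (hb0 p) j)]
    exact mul_le_mul (hBJ p) (pow_le_pow_left₀ (hb0 p) (gaugeDevSq_mem p.2).2 j) (pow_nonneg (hb0 p) j) hBJ0
  -- identification of the reweighted integrals with reweighted central transfers
  have hTa : ∀ k : ℕ, ∫ p, J p * a p ^ k ∂μP = fpFibreTransfer L β (fun x => Ω x * (‖x‖ ^ 2) ^ k) W (orthoTube L 1 v') 1 := fun k => by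
    unfold fpFibreTransfer; refine integral_congr_ae (ae_of_all _ fun p => ?_); rw [hJ, ha]; dsimp only; ring
  have hTb : ∀ j : ℕ, ∫ p, J p * b p ^ j ∂μP = fpFibreTransfer L β Ω (fun g => W g * (∑ x, ‖su2Quat (g x) - 1‖ ^ 2) ^ j) (orthoTube L 1 v') 1 := fun j => by
    unfold fpFibreTransfer; refine integral_congr_ae (ae_of_all _ fun p => ?_); rw [hJ, hb]; dsimp only; ring
  have hT0 : ∫ p, J p ∂μP = fpFibreTransfer L β Ω W (orthoTube L 1 v') 1 := rfl
  have hTI : ∫ p, I p ∂μP = fpFibreTransfer L β Ω W (orthoTube L u' v') u := rfl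
  -- pointwise: `I = ρ·J·e^X` and `|I − ρJ| ≤ 2ρ·J·H'`
  have hpt : ∀ p, I p = ρ * J p * Real.exp (offX L β u' u v' p.1 p.2 + diagX L β u' v' p.1 p.2) := fun p => by
    rw [hI, hJ]; dsimp only
    rw [transferKernel_orthoTube_transport (L := L) β u' u v' p.1 p.2, hρ]; ring
  have hbound : ∀ p, |I p - ρ * J p| ≤
      2 * ρ * ((c₀ + c₁ * s' + 3 * c₂ * s' ^ 2) * J p + c₁ * (J p * a p ^ 1 + J p * b p ^ 1) + 3 * c₂ * (J p * a p ^ 2 + J p * b p ^ 2)) := fun p => by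
    by_cases h0 : J p = 0
    · have hI0 : I p = 0 := by rw [hpt p, h0, mul_zero, zero_mul]
      rw [hI0, h0]; simp
    · have hWg : W p.2 ≠ 0 := by intro hz; apply h0; rw [hJ]; dsimp only; rw [hz, zero_mul, zero_mul]
      have hΩv : Ω (linkEmbed L p.1) ≠ 0 := by intro hz; apply h0; rw [hJ]; dsimp only; rw [hz, mul_zero]
      obtain ⟨hXle, hH1⟩ := hX p.1 p.2 hΩv hWg
      have hH0 : 0 ≤ c₀ + c₁ * (s' + a p + b p) + c₂ * (s' + a p + b p) ^ 2 := by
        have := ha0 p; have := hb0 p; positivity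
      have hX1 : |offX L β u' u v' p.1 p.2 + diagX L β u' v' p.1 p.2| ≤ 1 := hXle.trans hH1
      have hexp := Real.abs_exp_sub_one_le hX1
      have hJp : 0 ≤ ρ * J p := mul_nonneg hρ0.le (hJ0 p)
      have e1 : I p - ρ * J p = ρ * J p * (Real.exp (offX L β u' u v' p.1 p.2 + diagX L β u' v' p.1 p.2) - 1) := by rw [hpt p]; ring
      rw [e1, abs_mul, abs_of_nonneg hJp]
      -- `(s' + a + b)² ≤ 3(s'² + a² + b²)`
      have hsq : (s' + a p + b p) ^ 2 ≤ 3 * (s' ^ 2 + a p ^ 2 + b p ^ 2) := by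
        nlinarith [sq_nonneg (s' - a p), sq_nonneg (s' - b p), sq_nonneg (a p - b p)]
      have hH' : c₀ + c₁ * (s' + a p + b p) + c₂ * (s' + a p + b p) ^ 2 ≤
          (c₀ + c₁ * s' + 3 * c₂ * s' ^ 2) + c₁ * (a p ^ 1 + b p ^ 1) + 3 * c₂ * (a p ^ 2 + b p ^ 2) := by
        rw [pow_one, pow_one]; nlinarith [mul_le_mul_of_nonneg_left hsq hc₂]
      have hs'a : ‖linkEmbed L v'‖ ^ 2 + ‖linkEmbed L p.1‖ ^ 2 + ∑ x, ‖su2Quat (p.2 x) - 1‖ ^ 2 = s' + a p + b p := by rw [hs', ha, hb]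
      rw [hs'a] at hXle
      calc ρ * J p * |Real.exp (offX L β u' u v' p.1 p.2 + diagX L β u' v' p.1 p.2) - 1|
          ≤ ρ * J p * (2 * (c₀ + c₁ * (s' + a p + b p) + c₂ * (s' + a p + b p) ^ 2)) :=
            mul_le_mul_of_nonneg_left (hexp.trans (by linarith [hXle])) hJp
        _ ≤ ρ * J p * (2 * ((c₀ + c₁ * s' + 3 * c₂ * s' ^ 2) + c₁ * (a p ^ 1 + b p ^ 1) + 3 * c₂ * (a p ^ 2 + b p ^ 2))) :=
            mul_le_mul_of_nonneg_left (by linarith [hH']) hJp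
        _ = _ := by ring
  -- integrate
  have hG_int : Integrable (fun p => 2 * ρ * ((c₀ + c₁ * s' + 3 * c₂ * s' ^ 2) * J p + c₁ * (J p * a p ^ 1 + J p * b p ^ 1) + 3 * c₂ * (J p * a p ^ 2 + J p * b p ^ 2))) μP :=
    (((hJint.const_mul _).add (((hJa_int 1).add (hJb_int 1)).const_mul _)).add (((hJa_int 2).add (hJb_int 2)).const_mul _)).const_mul _
  have hdiff : fpFibreTransfer L β Ω W (orthoTube L u' v') u - ρ * fpFibreTransfer L β Ω W (orthoTube L 1 v') 1 = ∫ p, (I p - ρ * J p) ∂μP := by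
    rw [← hTI, ← hT0, integral_sub hIint (hJint.const_mul _), integral_const_mul]
  rw [hdiff]
  calc |∫ p, (I p - ρ * J p) ∂μP| ≤ ∫ p, |I p - ρ * J p| ∂μP := abs_integral_le_integral_abs
    _ ≤ ∫ p, 2 * ρ * ((c₀ + c₁ * s' + 3 * c₂ * s' ^ 2) * J p + c₁ * (J p * a p ^ 1 + J p * b p ^ 1) + 3 * c₂ * (J p * a p ^ 2 + J p * b p ^ 2)) ∂μP :=
        integral_mono_of_nonneg (ae_of_all _ fun _ => abs_nonneg _) hG_int (ae_of_all _ hbound)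
    _ = 2 * ρ * ((c₀ + c₁ * s' + 3 * c₂ * s' ^ 2) * fpFibreTransfer L β Ω W (orthoTube L 1 v') 1 +
          c₁ * (fpFibreTransfer L β (fun x => Ω x * (‖x‖ ^ 2) ^ 1) W (orthoTube L 1 v') 1 +
              fpFibreTransfer L β Ω (fun g => W g * (∑ x, ‖su2Quat (g x) - 1‖ ^ 2) ^ 1) (orthoTube L 1 v') 1) +
          3 * c₂ * (fpFibreTransfer L β (fun x => Ω x * (‖x‖ ^ 2) ^ 2) W (orthoTube L 1 v') 1 +
              fpFibreTransfer L β Ω (fun g => W g * (∑ x, ‖su2Quat (g x) - 1‖ ^ 2) ^ 2) (orthoTube L 1 v') 1)) := by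
        rw [integral_const_mul, integral_add, integral_add, integral_const_mul, integral_const_mul, integral_add, integral_const_mul, integral_add,
          hT0, hTa 1, hTb 1, hTa 2, hTb 2]
        · exact hJa_int 2
        · exact hJb_int 2
        · exact hJa_int 1
        · exact hJb_int 1
        · exact hJint.const_mul _
        · exact ((hJa_int 1).add (hJb_int 1)).const_mul _
        · exact (hJint.const_mul _).add (((hJa_int 1).add (hJb_int 1)).const_mul _)
        · exact ((hJa_int 2).add (hJb_int 2)).const_mul _

end Summit.QuantumFields.YangMills.Theorems.FemtoTransferGap.TwoLattice.ConstTube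

end
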